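import Summits.BirchSwinnertonDyer.Rank1Residual.GaloisImage.LocalOneUnitsModPCount
import HarnessLib

/-!
# The unit group `𝒪_Eˣ ≤ Eˣ` as a Galois module: stability, `U_1 ≤ 𝒪_Eˣ`, `u^{#(𝒪_E/p)ˣ} ∈ U_1`, finiteness of `𝒪_Eˣ/U_1`
# (cell `b2b-bsdres`, team n1011, row T-EPC = Tate's local Euler–Poincaré characteristic; seat p04 GEN 7; stage B4a)

HONEST FRAMING (cell `b2b-bsdres`, run/shared/lean/b2b/bsd-rank1-residual/, verbatim in every
file): the goal of the cell is to DELETE the COMBINATION-SHAPED residual classes of the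
Birch–Swinnerton-Dyer formula for ALL analytic-rank `≤ 1` elliptic curves over `ℚ` — "full BSD
formula for every rank `≤ 1` curve in class `C`" assembled STRICTLY from published theorems — so
that the rank-`≤ 1` remainder becomes exactly the CONSTRUCTION-SHAPED classes, which are TYPED
(missing-input `Prop`s), NOT attempted. This is not "finishing BSD". Team n1011 (N10 / N11, the
additive block X4 ∧ `p = 3`): research route; no claim beyond the stated classes; nothing is
booked; no mark / label is changed by this file. Theorems only (no definition, no named fact, no
`sorry`); TOOL theorems on local fields.  (Placement: Summits/GaloisImage pending the operator
move of the T-EPC cone to the Literature homes.)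

## What

`E/K` finite Galois, `E` a non-archimedean local field of characteristic `0` with `|p| < 1`,
`Δ = Gal(E/K)` with `p ∤ #Δ`, `Z` a finite `Δ`-module killed by `p`.  The unit group
`𝒪_Eˣ ≤ Eˣ` (as a membership-characterised `ℤ`-submodule `OU` of `Additive Eˣ`) contains
`U_1 = 1 + p𝒪_E` with finite quotient `(𝒪_E/p)ˣ` of order `m = p^a m'`, `p ∤ m'`.  With
`U♭ = {u ∈ 𝒪_Eˣ | u^{p^a} ∈ U_1}` (`𝒪_Eˣ / U♭` of order prime to `p`, `p^a U♭ ≤ U_1`) is the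
intermediate subgroup through which the sequel (stage B4b) transfers the class identity
`[U/p] − [U[p]] = [𝒪_E/p]` from `U_1` (stage B3) to `U = 𝒪_Eˣ` (Milne's Lemma 2.12 with torsion,
stage A4, for `U♭ ⊇ U_1`; Bezout for `𝒪_Eˣ ⊇ U♭`).  This file provides the inputs:

* `OneUnits.exists_submodule_units`, `units_le_comap` (Galois stability), `one_le_units`
  (`U_1 ≤ 𝒪_Eˣ`);
* `OneUnits.nsmul_card_mem_one` — `u^m ∈ U_1` for every unit `u`, `m = #(𝒪_E/p)ˣ` (Lagrange);
* `OneUnits.finite_units_quotient_one` — `𝒪_Eˣ/U_1` is finite (it embeds in `(𝒪_E/p)ˣ` by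
  reduction; the kernel of the reduction is exactly `U_1`).

References: J. S. Milne, *Arithmetic Duality Theorems* (2006), I §2, proof of Thm. 2.8
(Lemmas 2.11–2.12) [MilneADT2006]; J.-P. Serre, *Local Fields*, IV §2 [SerreLocalFields1979].
-/

noncomputable section

open Function
open scoped ValuativeRel

namespace Summit.BirchSwinnertonDyer.Rank1Residual.GaloisImage

namespace OneUnits

open Representation

variable {K : Type*} [Field K] {E : Type*} [Field E] [Algebra K E] [ValuativeRel E]
  [TopologicalSpace E] [IsNonarchimedeanLocalField E]
variable (p : ℕ) [hp : Fact p.Prime]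

/-! ### The unit group `𝒪_Eˣ ≤ Eˣ` -/

section Units

omit hp [TopologicalSpace E] [IsNonarchimedeanLocalField E] in
/-- **`𝒪_Eˣ` as a subgroup of `Eˣ`** (a `ℤ`-submodule of `Additive Eˣ` characterised by membership:
`u` and `u⁻¹` are integers). [folklore] -/
theorem exists_submodule_units :
    ∃ OU : Submodule ℤ (Additive Eˣ), ∀ u : Additive Eˣ,
      u ∈ OU ↔ ((Additive.toMul u : Eˣ) : E) ∈ 𝒪[E] ∧ (((Additive.toMul u)⁻¹ : Eˣ) : E) ∈ 𝒪[E] := by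
  let S : Subgroup Eˣ :=
    { carrier := {u | (u : E) ∈ 𝒪[E] ∧ ((u⁻¹ : Eˣ) : E) ∈ 𝒪[E]}
      mul_mem' := by
        rintro u w ⟨hu, hu'⟩ ⟨hw, hw'⟩
        refine ⟨?_, ?_⟩
        · rw [Units.val_mul]; exact Subring.mul_mem _ hu hw
        · rw [mul_inv_rev, Units.val_mul]; exact Subring.mul_mem _ hw' hu'
      one_mem' := ⟨by simp, by simp⟩
      inv_mem' := by
        rintro u ⟨hu, hu'⟩
        exact ⟨hu', by rw [inv_inv]; exact hu⟩ }
  exact ⟨AddSubgroup.toIntSubmodule (Subgroup.toAddSubgroup S), fun u => Iff.rfl⟩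

omit hp [TopologicalSpace E] [IsNonarchimedeanLocalField E] in
/-- `𝒪_Eˣ` is `Gal(E/K)`-stable when the Galois group preserves the valuation. [folklore] -/
theorem units_le_comap
    (hσ : ∀ (σ : E ≃ₐ[K] E) (x : E), ValuativeRel.valuation E (σ x) = ValuativeRel.valuation E x)
    (OU : Submodule ℤ (Additive Eˣ))
    (hOU : ∀ u : Additive Eˣ, u ∈ OU ↔
      ((Additive.toMul u : Eˣ) : E) ∈ 𝒪[E] ∧ (((Additive.toMul u)⁻¹ : Eˣ) : E) ∈ 𝒪[E])
    (σ : E ≃ₐ[K] E) :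
    OU ≤ OU.comap (Representation.ofMulDistribMulAction (E ≃ₐ[K] E) Eˣ σ) := by
  intro u hu
  obtain ⟨h1, h2⟩ := (hOU u).1 hu
  rw [Submodule.mem_comap, hOU]
  refine ⟨?_, ?_⟩
  · rw [coe_ofMulDistribMulAction_apply]; exact map_mem_integer (hσ σ) h1
  · have : (((Additive.toMul (Representation.ofMulDistribMulAction (E ≃ₐ[K] E) Eˣ σ u))⁻¹ : Eˣ) : E) =
        σ (((Additive.toMul u)⁻¹ : Eˣ) : E) := by
      rw [Representation.ofMulDistribMulAction_apply_apply, toMul_ofMul, ← smul_inv']; rfl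
    rw [this]; exact map_mem_integer (hσ σ) h2

omit hp [TopologicalSpace E] [IsNonarchimedeanLocalField E] in
/-- `U_1 ≤ 𝒪_Eˣ`. [folklore] -/
theorem one_le_units (hpv : ValuativeRel.valuation E p < 1) (OU U₁ : Submodule ℤ (Additive Eˣ))
    (hOU : ∀ u : Additive Eˣ, u ∈ OU ↔
      ((Additive.toMul u : Eˣ) : E) ∈ 𝒪[E] ∧ (((Additive.toMul u)⁻¹ : Eˣ) : E) ∈ 𝒪[E])
    (hU₁ : ∀ u : Additive Eˣ, u ∈ U₁ ↔ ∃ b ∈ 𝒪[E], ((Additive.toMul u : Eˣ) : E) = 1 + (p : E) ^ 1 * b) :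
    U₁ ≤ OU := by
  intro u hu
  obtain ⟨b, hb, hub⟩ := (hU₁ u).1 hu
  refine (hOU u).2 ⟨?_, inv_mem_integer p hpv le_rfl hb hub⟩
  rw [Valuation.mem_integer_iff, hub, valuation_one_add_eq_one p hpv le_rfl hb]

omit hp [TopologicalSpace E] [IsNonarchimedeanLocalField E] in
/-- **`u^m ∈ U_1` for `m = #(𝒪_E/p)ˣ`** and every unit `u` (Lagrange in the group `(𝒪_E/p𝒪_E)ˣ`,
through which `𝒪_Eˣ/U_1` factors; `Nat.card`-form, so no finiteness hypothesis is needed).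
[folklore] -/
theorem nsmul_card_mem_one (OU U₁ : Submodule ℤ (Additive Eˣ))
    (hOU : ∀ u : Additive Eˣ, u ∈ OU ↔
      ((Additive.toMul u : Eˣ) : E) ∈ 𝒪[E] ∧ (((Additive.toMul u)⁻¹ : Eˣ) : E) ∈ 𝒪[E])
    (hU₁ : ∀ u : Additive Eˣ, u ∈ U₁ ↔ ∃ b ∈ 𝒪[E], ((Additive.toMul u : Eˣ) : E) = 1 + (p : E) ^ 1 * b)
    {u : Additive Eˣ} (hu : u ∈ OU) :
    Nat.card ((𝒪[E] ⧸ Ideal.span {(p : 𝒪[E])})ˣ) • u ∈ U₁ := by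
  classical
  obtain ⟨h1, h2⟩ := (hOU u).1 hu
  let x : (𝒪[E])ˣ := ⟨⟨_, h1⟩, ⟨_, h2⟩, Subtype.ext (Units.mul_inv _), Subtype.ext (Units.inv_mul _)⟩
  have hx : ((x : 𝒪[E]) : E) = ((Additive.toMul u : Eˣ) : E) := rfl
  let r : (𝒪[E] ⧸ Ideal.span {(p : 𝒪[E])})ˣ :=
    Units.map (Ideal.Quotient.mk (Ideal.span {(p : 𝒪[E])})).toMonoidHom x
  have hr : r ^ Nat.card ((𝒪[E] ⧸ Ideal.span {(p : 𝒪[E])})ˣ) = 1 := pow_card_eq_one'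
  have hmk : Ideal.Quotient.mk (Ideal.span {(p : 𝒪[E])})
      ((x ^ Nat.card ((𝒪[E] ⧸ Ideal.span {(p : 𝒪[E])})ˣ) : (𝒪[E])ˣ) : 𝒪[E]) = 1 := by
    have h := congrArg (fun t : (𝒪[E] ⧸ Ideal.span {(p : 𝒪[E])})ˣ => (t : 𝒪[E] ⧸ Ideal.span {(p : 𝒪[E])})) hr
    simp only [r, ← map_pow, Units.coe_map, RingHom.toMonoidHom_eq_coe, MonoidHom.coe_coe,
      Units.val_one] at h
    exact h
  rw [← (Ideal.Quotient.mk _).map_one, Ideal.Quotient.eq, Ideal.mem_span_singleton'] at hmk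
  obtain ⟨c, hc⟩ := hmk
  refine (hU₁ _).2 ⟨(c : E), c.2, ?_⟩
  rw [toMul_nsmul, Units.val_pow_eq_pow_val, ← hx, pow_one]
  have hc' := congrArg (fun t : 𝒪[E] => (t : E)) hc
  push_cast at hc'
  linear_combination -hc'

end Units

/-! ### `𝒪_Eˣ / U_1` is finite -/

section FiniteIndex

/-- `𝒪_Eˣ/U_1` is finite: it embeds in `(𝒪_E/p)ˣ` (reduction modulo `p`; the kernel of the reduction
is exactly `U_1 = 1 + p𝒪_E`).  Stated for the pull-back of `U_1` to the subgroup `𝒪_Eˣ`.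
[folklore] -/
theorem finite_units_quotient_one [CharZero E] (hpv : ValuativeRel.valuation E p < 1)
    (OU U₁ : Submodule ℤ (Additive Eˣ))
    (hOU : ∀ u : Additive Eˣ, u ∈ OU ↔
      ((Additive.toMul u : Eˣ) : E) ∈ 𝒪[E] ∧ (((Additive.toMul u)⁻¹ : Eˣ) : E) ∈ 𝒪[E])
    (hU₁ : ∀ u : Additive Eˣ, u ∈ U₁ ↔ ∃ b ∈ 𝒪[E], ((Additive.toMul u : Eˣ) : E) = 1 + (p : E) ^ 1 * b) :
    Finite (OU ⧸ U₁.comap OU.subtype) := by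
  classical
  have hp0 : (p : E) ≠ 0 := Nat.cast_ne_zero.2 hp.out.ne_zero
  obtain ⟨U₂, hU₂⟩ := exists_submodule p hpv (by norm_num : 1 ≤ 2) (E := E)
  haveI : Finite (𝒪[E] ⧸ Ideal.span {(p : 𝒪[E])}) := (natCard_quotient_two_eq p hpv U₂ hU₂).2
  -- the reduction map `OU → Additive (𝒪/p)ˣ`
  let toO : OU → (𝒪[E])ˣ := fun u =>
    ⟨⟨_, ((hOU _).1 u.2).1⟩, ⟨_, ((hOU _).1 u.2).2⟩, Subtype.ext (Units.mul_inv _), Subtype.ext (Units.inv_mul _)⟩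
  let red : OU →+ Additive ((𝒪[E] ⧸ Ideal.span {(p : 𝒪[E])})ˣ) :=
    { toFun := fun u => Additive.ofMul (Units.map (Ideal.Quotient.mk _).toMonoidHom (toO u))
      map_zero' := by
        refine congrArg Additive.ofMul (Units.ext ?_)
        simp only [Units.coe_map, RingHom.toMonoidHom_eq_coe, MonoidHom.coe_coe, Units.val_one]
        rw [← (Ideal.Quotient.mk _).map_one]
        exact congrArg _ (Subtype.ext (by rfl))
      map_add' := fun u w => by
        rw [← ofMul_mul, ← map_mul]
        refine congrArg Additive.ofMul (congrArg _ (Units.ext (Subtype.ext ?_)))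
        change ((Additive.toMul ((u + w : OU) : Additive Eˣ) : Eˣ) : E) = _
        rw [Submodule.coe_add, toMul_add, Units.val_mul]; rfl }
  have hker : ∀ u : OU, red u = 0 ↔ (u : Additive Eˣ) ∈ U₁ := by
    intro u
    change Additive.ofMul _ = Additive.ofMul 1 ↔ _
    rw [Additive.ofMul.injective.eq_iff, Units.ext_iff, Units.coe_map, RingHom.toMonoidHom_eq_coe,
      MonoidHom.coe_coe, Units.val_one, ← (Ideal.Quotient.mk _).map_one, Ideal.Quotient.eq,
      Ideal.mem_span_singleton', hU₁]
    constructor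
    · rintro ⟨c, hc⟩
      refine ⟨(c : E), c.2, ?_⟩
      have hc' := congrArg (fun t : 𝒪[E] => (t : E)) hc
      push_cast at hc'
      change ((Additive.toMul (u : Additive Eˣ) : Eˣ) : E) = _
      rw [pow_one]; linear_combination -hc'
    · rintro ⟨b, hb, hub⟩
      refine ⟨⟨b, hb⟩, Subtype.ext ?_⟩
      push_cast
      change (b : E) * p = ((Additive.toMul (u : Additive Eˣ) : Eˣ) : E) - 1
      rw [hub, pow_one]; ring
  have hkerEq : (U₁.comap OU.subtype).toAddSubgroup = red.ker := by
    ext u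
    rw [Submodule.mem_toAddSubgroup, Submodule.mem_comap, AddMonoidHom.mem_ker]
    exact (hker u).symm
  haveI : Finite red.range := Finite.of_injective _ Subtype.coe_injective
  have e := (QuotientAddGroup.quotientAddEquivOfEq hkerEq).trans (QuotientAddGroup.quotientKerEquivRange red)
  exact Finite.of_equiv _ e.symm.toEquiv

end FiniteIndex

end OneUnits

end Summit.BirchSwinnertonDyer.Rank1Residual.GaloisImage

end
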